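import Summits.QuantumFields.YangMills.Theorems.LuscherReductionOneSiteLevelsValleyAlgebra
import Summits.QuantumFields.YangMills.Theorems.FemtoTransferGapBounds
import Summits.QuantumFields.YangMills.Theorems.LuscherReductionOneSiteLevelsIMS
import Literature.Analysis.OperatorTheory.SchurTestKernel

/-!
# VALLEY, step 3a: kernel facts and bilinear bounds for the two-shell Schur assembly
# (support module for `stub_absUpperValleyMag` of crux `OneSiteLevels`, route `LuscherReduction`, item stmt-QuantumFields-20007;
# fleet lead prover ym-luscher-20007-p1 g2)

Abstract assembly of the VALLEY gain from per-shell supersolution bounds.  Fix `B > 0`, an inner radius `ρ₀` (the test function `f`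
vanishes on `{ρ < ρ₀}`, `ρ(U) = ‖zmCoord 1 U‖`), a window `[T, 2T]` for the shell boundary and a slab width `w`.  Suppose that for EVERY
boundary `t ∈ [T, 2T]` the weighted supersolution quantities

  `J_τ(U) = e^{(τ−½)BS(U)} ∫ E_B(U,V) e^{−(½+τ)BS(V)} dV`

satisfy `J_{τ(t)}(U) ≤ Λ` on the lower shell `ρ₀ ≤ ρ(U) < t` and `J_0(U) ≤ Λ` on the upper shell `ρ(U) ≥ t`.  Then (`qform_le_of_twoShell`)

  `⟨f, K_B f⟩ ≤ (Λ + linkCE B / J + 3 e^{6B − Bw²}) ‖f‖²`,   `J` = number of disjoint candidate slabs in the window.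

Proof: choose the boundary `t` among `J` candidates so that the slab `{t − w ≤ ρ < t + w}` carries at most `‖f‖²/J` of the mass of `f`
(pigeonhole); split `f = f₁ + f₂` along `t`; the diagonal terms are bounded by the WEIGHTED SCHUR TEST (`Literature.…SchurTestKernel`,
weights `e^{−τBS}` and `1`), the cross terms between the slab halves by the unweighted Schur test (row sums `linkCE`), and all other cross
terms by the Gaussian decay of the kinetic factor across a radial gap `w`: `E_B(U,V) ≤ e^{6B − B(ρ(U)−ρ(V))²}` (`linkE_le_exp_gap`).
No positivity of the transfer form is used (the split is an exact bilinear expansion), so no constant is lost.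

## WHAT THIS IS NOT
The per-shell bounds are hypotheses here (modules `…ValleyFar`, `…ValleyNear`); NOT the crux, NOT THE CLAY GAP.  Sorry-free; no new
definition, no named fact.
-/

set_option autoImplicit false

noncomputable section

open MeasureTheory Filter Topology Real
open scoped Matrix Quaternion RealInnerProductSpace
open Literature.MathematicalPhysics.QuantumFieldTheory
open Literature.MathematicalPhysics.QuantumLattice
open Literature.Analysis.OperatorTheory.YMMatrixModel
open Literature.Analysis.OperatorTheory.SchurTest

namespace Summit.QuantumFields.YangMills.Theorems.FemtoTransferGap

/-! ### §1. Kernel facts: the bound `S ≤ 12`, the radial Gaussian decay of `E_B`, measurability -/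

/-- `S(U) ≤ 4·#plaquettes` on the one-site torus (each `2 − Re tr ≤ 4`). [folklore] -/
theorem wilsonAction_su2_le_card (U : Cfg) : wilsonAction su2Rep U ≤ 4 * Fintype.card (Plaquette 3 1) := by
  unfold wilsonAction
  calc ∑ p : Plaquette 3 1, ((2 : ℕ) - (su2Rep (plaquetteHolonomy U p.1 p.2.1.1 p.2.1.2)).trace.re : ℝ)
      ≤ ∑ _p : Plaquette 3 1, (4 : ℝ) := Finset.sum_le_sum fun p _ => by
        have h := neg_two_le_re_trace (plaquetteHolonomy U p.1 p.2.1.1 p.2.1.2)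
        simp only [fundamentalRep_apply, Nat.cast_ofNat]
        linarith
    _ = 4 * Fintype.card (Plaquette 3 1) := by rw [Finset.sum_const, Finset.card_univ, nsmul_eq_mul]; ring

/-- The valley radius is continuous. [folklore] -/
theorem continuous_valleyRadius : Continuous fun U : Cfg => ‖zmCoord 1 U‖ :=
  continuous_norm.comp (continuous_zmCoord 1)

/-- **Radial Gaussian decay of the kinetic factor**: `E_B(U,V) ≤ exp(6B − B(ρ(U) − ρ(V))²)` (`B ≥ 0`), since
`Σ_e Re tr(U_eV_e⁻¹) = 6 − Σ_e |q_{U_e} − q_{V_e}|² ≤ 6 − ‖zmCoord 1 U − zmCoord 1 V‖² ≤ 6 − (ρ(U) − ρ(V))²`. [folklore] -/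
theorem linkE_le_exp_gap {B : ℝ} (hB : 0 ≤ B) (U V : Cfg) :
    linkE B U V ≤ Real.exp (6 * B - B * (‖zmCoord 1 U‖ - ‖zmCoord 1 V‖) ^ 2) := by
  rw [linkE_eq_exp]
  refine Real.exp_le_exp.2 ?_
  -- `tc ≤ 6 − ‖x_U − x_V‖²`
  have htc : timeCoupling su2Rep U V ≤ 6 - ‖zmCoord 1 U - zmCoord 1 V‖ ^ 2 := by
    unfold timeCoupling
    have hx : ‖zmCoord 1 U - zmCoord 1 V‖ ^ 2 = ∑ i : Fin 3, ∑ a : Fin 3, (vecPart (U (edgeOf i)) a - vecPart (V (edgeOf i)) a) ^ 2 := by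
      rw [EuclideanSpace.norm_sq_eq, Fintype.sum_prod_type]
      refine Finset.sum_congr rfl fun i _ => Finset.sum_congr rfl fun a _ => ?_
      rw [Real.norm_eq_abs, sq_abs]
      simp [zmCoord_apply]
    rw [hx, ← edgeFin.symm.sum_comp]
    have h6 : (6 : ℝ) = ∑ _i : Fin 3, (2 : ℝ) := by simp; norm_num
    rw [h6, ← Finset.sum_sub_distrib]
    refine Finset.sum_le_sum fun i _ => ?_
    show (((su2Rep (U (edgeOf i) * (V (edgeOf i))⁻¹))).trace).re ≤ 2 - ∑ a : Fin 3, (vecPart (U (edgeOf i)) a - vecPart (V (edgeOf i)) a) ^ 2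
    rw [fundamentalRep_apply]
    set X := U (edgeOf i)
    set Y := V (edgeOf i)
    rw [show (((X * Y⁻¹ : SU2) : Matrix (Fin 2) (Fin 2) ℂ).trace).re = 2 * ⟪su2Quat X, su2Quat Y⟫ from
      re_trace_mul_inv_eq_two_inner X Y]
    -- `2⟨q_X, q_Y⟩ = 2 − |q_X − q_Y|²`, `|q_X − q_Y|² ≥ Σ_a (x_a − y_a)²`
    have hn : ‖su2Quat X - su2Quat Y‖ ^ 2 = 2 - 2 * ⟪su2Quat X, su2Quat Y⟫ := by
      rw [@norm_sub_sq_real, norm_su2Quat, norm_su2Quat]; ring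
    have hn2 : ‖su2Quat X - su2Quat Y‖ ^ 2 = Quaternion.normSq (su2Quat X - su2Quat Y) := by
      rw [Quaternion.normSq_eq_norm_mul_self]; ring
    have hsq : Quaternion.normSq (su2Quat X - su2Quat Y)
        = (su2Quat X - su2Quat Y).re ^ 2 + ∑ a : Fin 3, (vecPart X a - vecPart Y a) ^ 2 := by
      rw [Quaternion.normSq_def']
      show (su2Quat X - su2Quat Y).re ^ 2 + (su2Quat X - su2Quat Y).imI ^ 2 + (su2Quat X - su2Quat Y).imJ ^ 2
        + (su2Quat X - su2Quat Y).imK ^ 2 = _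
      simp only [vecPart, Fin.sum_univ_three, Matrix.cons_val_zero, Matrix.cons_val_one, Matrix.head_cons, Matrix.cons_val_two,
        Matrix.tail_cons, Quaternion.imI_sub, Quaternion.imJ_sub, Quaternion.imK_sub]
      ring
    rw [hn2, hsq] at hn
    nlinarith [sq_nonneg (su2Quat X - su2Quat Y).re]
  -- reverse triangle inequality
  have hrt : (‖zmCoord 1 U‖ - ‖zmCoord 1 V‖) ^ 2 ≤ ‖zmCoord 1 U - zmCoord 1 V‖ ^ 2 := by
    have h := abs_norm_sub_norm_le (zmCoord 1 U) (zmCoord 1 V)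
    calc (‖zmCoord 1 U‖ - ‖zmCoord 1 V‖) ^ 2 = |‖zmCoord 1 U‖ - ‖zmCoord 1 V‖| ^ 2 := (sq_abs _).symm
      _ ≤ ‖zmCoord 1 U - zmCoord 1 V‖ ^ 2 := pow_le_pow_left₀ (abs_nonneg _) h 2
  nlinarith

/-- `K_B(U,V) ≤ e^{6B − B(ρ(U) − ρ(V))²}`. [folklore] -/
theorem transferKernel_le_exp_gap {B : ℝ} (hB : 0 ≤ B) (U V : Cfg) :
    transferKernel su2Rep B U V ≤ Real.exp (6 * B - B * (‖zmCoord 1 U‖ - ‖zmCoord 1 V‖) ^ 2) :=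
  (transferKernel_le_linkE hB U V).trans (linkE_le_exp_gap hB U V)

/-! ### §2. Three bilinear bounds in product-measure form -/

section Bilinear

variable {B : ℝ}

/-- A restriction `1_A · f` of a bounded measurable function is bounded and measurable. [folklore] -/
theorem measurable_indicator_mul {A : Set Cfg} (hA : MeasurableSet A) {f : Cfg → ℝ} (hf : Measurable f) :
    Measurable (A.indicator f) := hf.indicator hA

/-- `|1_A f| ≤ C` if `|f| ≤ C`. [folklore] -/
theorem abs_indicator_le {A : Set Cfg} {f : Cfg → ℝ} {C : ℝ} (hC : ∀ U, |f U| ≤ C) (U : Cfg) : |A.indicator f U| ≤ C := by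
  by_cases h : U ∈ A
  · rw [Set.indicator_of_mem h]; exact hC U
  · rw [Set.indicator_of_notMem h, abs_zero]; exact (abs_nonneg _).trans (hC U)

/-- The bilinear transfer integrand `a(U) K_B(U,V) b(V)` is integrable on the product for bounded measurable `a, b`. [folklore] -/
theorem integrable_bilin (hB : 0 ≤ B) {a b : Cfg → ℝ} (ha : Measurable a) (hb : Measurable b)
    (hab : ∃ C : ℝ, ∀ U, |a U| ≤ C) (hbb : ∃ C : ℝ, ∀ U, |b U| ≤ C) :
    Integrable (fun p : Cfg × Cfg => a p.1 * transferKernel su2Rep B p.1 p.2 * b p.2)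
      ((configMeasure SU2 1).prod (configMeasure SU2 1)) := by
  obtain ⟨C, hC⟩ := hab
  obtain ⟨C', hC'⟩ := hbb
  exact integrable_sandwich' (measurable_transferKernel_su2 B) (abs_transferKernel_le hB) ha hb hC hC'

/-- **Bilinear expansion** in the first slot. [folklore] -/
theorem prodIntegral_add_left (hB : 0 ≤ B) {a₁ a₂ b : Cfg → ℝ} (ha₁ : Measurable a₁) (ha₂ : Measurable a₂) (hb : Measurable b)
    (h₁ : ∃ C : ℝ, ∀ U, |a₁ U| ≤ C) (h₂ : ∃ C : ℝ, ∀ U, |a₂ U| ≤ C) (hbb : ∃ C : ℝ, ∀ U, |b U| ≤ C) :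
    ∫ p, (a₁ p.1 + a₂ p.1) * transferKernel su2Rep B p.1 p.2 * b p.2 ∂((configMeasure SU2 1).prod (configMeasure SU2 1))
      = (∫ p, a₁ p.1 * transferKernel su2Rep B p.1 p.2 * b p.2 ∂((configMeasure SU2 1).prod (configMeasure SU2 1)))
        + ∫ p, a₂ p.1 * transferKernel su2Rep B p.1 p.2 * b p.2 ∂((configMeasure SU2 1).prod (configMeasure SU2 1)) := by
  rw [← integral_add (integrable_bilin hB ha₁ hb h₁ hbb) (integrable_bilin hB ha₂ hb h₂ hbb)]
  refine integral_congr_ae (ae_of_all _ fun p => ?_)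
  ring

/-- **Bilinear expansion** in the second slot. [folklore] -/
theorem prodIntegral_add_right (hB : 0 ≤ B) {a b₁ b₂ : Cfg → ℝ} (ha : Measurable a) (hb₁ : Measurable b₁) (hb₂ : Measurable b₂)
    (hab : ∃ C : ℝ, ∀ U, |a U| ≤ C) (h₁ : ∃ C : ℝ, ∀ U, |b₁ U| ≤ C) (h₂ : ∃ C : ℝ, ∀ U, |b₂ U| ≤ C) :
    ∫ p, a p.1 * transferKernel su2Rep B p.1 p.2 * (b₁ p.2 + b₂ p.2) ∂((configMeasure SU2 1).prod (configMeasure SU2 1))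
      = (∫ p, a p.1 * transferKernel su2Rep B p.1 p.2 * b₁ p.2 ∂((configMeasure SU2 1).prod (configMeasure SU2 1)))
        + ∫ p, a p.1 * transferKernel su2Rep B p.1 p.2 * b₂ p.2 ∂((configMeasure SU2 1).prod (configMeasure SU2 1)) := by
  rw [← integral_add (integrable_bilin hB ha hb₁ hab h₁) (integrable_bilin hB ha hb₂ hab h₂)]
  refine integral_congr_ae (ae_of_all _ fun p => ?_)
  ring

/-- `∫ (c₁ g(U)² + c₂ h(V)²) d(μ⊗μ) = c₁ ∫ g² + c₂ ∫ h²` for the probability measure `μ` and bounded measurable `g, h`. [folklore] -/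
theorem prodIntegral_sq_fst_add_snd {g h : Cfg → ℝ} (hg : Measurable g) (hh : Measurable h)
    (hgb : ∃ C : ℝ, ∀ U, |g U| ≤ C) (hhb : ∃ C : ℝ, ∀ U, |h U| ≤ C) (c₁ c₂ : ℝ) :
    ∫ p, (c₁ * g p.1 ^ 2 + c₂ * h p.2 ^ 2) ∂((configMeasure SU2 1).prod (configMeasure SU2 1))
      = c₁ * (∫ U, g U ^ 2 ∂(configMeasure SU2 1)) + c₂ * ∫ U, h U ^ 2 ∂(configMeasure SU2 1) := by
  obtain ⟨C, hC⟩ := hgb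
  obtain ⟨C', hC'⟩ := hhb
  have hg2 : ∀ U, |g U ^ 2| ≤ C ^ 2 := fun U => by rw [abs_pow]; exact pow_le_pow_left₀ (abs_nonneg _) (hC U) 2
  have hh2 : ∀ U, |h U ^ 2| ≤ C' ^ 2 := fun U => by rw [abs_pow]; exact pow_le_pow_left₀ (abs_nonneg _) (hC' U) 2
  have i1 : Integrable (fun p : Cfg × Cfg => c₁ * g p.1 ^ 2) ((configMeasure SU2 1).prod (configMeasure SU2 1)) :=
    (integrable_cfgProd ((hg.pow_const 2).comp measurable_fst) fun p => hg2 p.1).const_mul c₁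
  have i2 : Integrable (fun p : Cfg × Cfg => c₂ * h p.2 ^ 2) ((configMeasure SU2 1).prod (configMeasure SU2 1)) :=
    (integrable_cfgProd ((hh.pow_const 2).comp measurable_snd) fun p => hh2 p.2).const_mul c₂
  rw [integral_add i1 i2, integral_const_mul, integral_const_mul]
  have e1 := integral_fun_fst (μ := configMeasure SU2 1) (ν := configMeasure SU2 1) (fun U : Cfg => g U ^ 2)
  have e2 := integral_fun_snd (μ := configMeasure SU2 1) (ν := configMeasure SU2 1) (fun U : Cfg => h U ^ 2)
  simp only [probReal_univ, one_smul] at e1 e2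
  rw [e1, e2]

/-- **Separated supports**: if `K_B ≤ ε` wherever `a(U) ≠ 0 ≠ b(V)`, then `∫ a K_B b ≤ (ε/2)(∫a² + ∫b²)`. [folklore] -/
theorem prodIntegral_le_of_sep (hB : 0 ≤ B) {ε : ℝ} (hε : 0 ≤ ε) {a b : Cfg → ℝ} (ha : Measurable a) (hb : Measurable b)
    (hab : ∃ C : ℝ, ∀ U, |a U| ≤ C) (hbb : ∃ C : ℝ, ∀ U, |b U| ≤ C)
    (hsep : ∀ U V, a U ≠ 0 → b V ≠ 0 → transferKernel su2Rep B U V ≤ ε) :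
    ∫ p, a p.1 * transferKernel su2Rep B p.1 p.2 * b p.2 ∂((configMeasure SU2 1).prod (configMeasure SU2 1))
      ≤ ε / 2 * ((∫ U, a U ^ 2 ∂(configMeasure SU2 1)) + ∫ U, b U ^ 2 ∂(configMeasure SU2 1)) := by
  have hpt : ∀ p : Cfg × Cfg, a p.1 * transferKernel su2Rep B p.1 p.2 * b p.2 ≤ ε / 2 * a p.1 ^ 2 + ε / 2 * b p.2 ^ 2 := by
    intro p
    have hK := transferKernel_pos su2Rep B p.1 p.2
    by_cases h1 : a p.1 = 0
    · rw [h1]; nlinarith [sq_nonneg (b p.2)]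
    by_cases h2 : b p.2 = 0
    · rw [h2]; nlinarith [sq_nonneg (a p.1)]
    have hKε := hsep p.1 p.2 h1 h2
    have hab2 : |a p.1| * |b p.2| ≤ (a p.1 ^ 2 + b p.2 ^ 2) / 2 := by
      nlinarith [sq_nonneg (|a p.1| - |b p.2|), sq_abs (a p.1), sq_abs (b p.2)]
    calc a p.1 * transferKernel su2Rep B p.1 p.2 * b p.2 ≤ |a p.1 * transferKernel su2Rep B p.1 p.2 * b p.2| := le_abs_self _
      _ = |a p.1| * |b p.2| * transferKernel su2Rep B p.1 p.2 := by rw [abs_mul, abs_mul, abs_of_pos hK]; ring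
      _ ≤ (a p.1 ^ 2 + b p.2 ^ 2) / 2 * ε := mul_le_mul hab2 hKε hK.le (by positivity)
      _ = ε / 2 * a p.1 ^ 2 + ε / 2 * b p.2 ^ 2 := by ring
  have hI := integrable_bilin hB ha hb hab hbb
  obtain ⟨C, hC⟩ := hab
  obtain ⟨C', hC'⟩ := hbb
  have hg2 : ∀ U, |a U ^ 2| ≤ C ^ 2 := fun U => by rw [abs_pow]; exact pow_le_pow_left₀ (abs_nonneg _) (hC U) 2
  have hh2 : ∀ U, |b U ^ 2| ≤ C' ^ 2 := fun U => by rw [abs_pow]; exact pow_le_pow_left₀ (abs_nonneg _) (hC' U) 2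
  have hR : Integrable (fun p : Cfg × Cfg => ε / 2 * a p.1 ^ 2 + ε / 2 * b p.2 ^ 2) ((configMeasure SU2 1).prod (configMeasure SU2 1)) :=
    ((integrable_cfgProd ((ha.pow_const 2).comp measurable_fst) fun p => hg2 p.1).const_mul _).add
      ((integrable_cfgProd ((hb.pow_const 2).comp measurable_snd) fun p => hh2 p.2).const_mul _)
  refine (integral_mono hI hR hpt).trans (le_of_eq ?_)
  rw [prodIntegral_sq_fst_add_snd ha hb ⟨C, hC⟩ ⟨C', hC'⟩]
  ring

/-- **Near slabs (unweighted Schur)**: `∫ a K_B b ≤ (linkCE B/2)(∫a² + ∫b²)`. [cite: Helffer2013, Lemma 7.1 pp.77–78] -/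
theorem prodIntegral_le_linkCE (hB : 0 ≤ B) {a b : Cfg → ℝ} (ha : Measurable a) (hb : Measurable b)
    (hab : ∃ C : ℝ, ∀ U, |a U| ≤ C) (hbb : ∃ C : ℝ, ∀ U, |b U| ≤ C) :
    ∫ p, a p.1 * transferKernel su2Rep B p.1 p.2 * b p.2 ∂((configMeasure SU2 1).prod (configMeasure SU2 1))
      ≤ linkCE B / 2 * ((∫ U, a U ^ 2 ∂(configMeasure SU2 1)) + ∫ U, b U ^ 2 ∂(configMeasure SU2 1)) := by
  have hI := integrable_bilin hB ha hb hab hbb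
  obtain ⟨C, hC⟩ := hab
  obtain ⟨C', hC'⟩ := hbb
  have ha2m : Measurable fun U => a U ^ 2 := ha.pow_const 2
  have hb2m : Measurable fun U => b U ^ 2 := hb.pow_const 2
  have ha2b : ∀ U, |a U ^ 2| ≤ C ^ 2 := fun U => by rw [abs_pow]; exact pow_le_pow_left₀ (abs_nonneg _) (hC U) 2
  have hb2b : ∀ U, |b U ^ 2| ≤ C' ^ 2 := fun U => by rw [abs_pow]; exact pow_le_pow_left₀ (abs_nonneg _) (hC' U) 2
  have e1 := integral_prod_linkE_mul_fst B ha2m ha2b hB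
  have e2 := integral_prod_linkE_mul_snd B hb2m hb2b hB
  have hG1 : Integrable (fun p : Cfg × Cfg => linkE B p.1 p.2 * a p.1 ^ 2) ((configMeasure SU2 1).prod (configMeasure SU2 1)) := by
    refine integrable_cfgProd ((measurable_linkE B).mul (ha2m.comp measurable_fst))
      (C := Real.exp (2 * B) ^ Fintype.card (Edge 3 1) * C ^ 2) fun p => ?_
    rw [abs_mul]; exact mul_le_mul (abs_linkE_le hB _ _) (ha2b _) (abs_nonneg _) (by positivity)
  have hG2 : Integrable (fun p : Cfg × Cfg => linkE B p.1 p.2 * b p.2 ^ 2) ((configMeasure SU2 1).prod (configMeasure SU2 1)) := by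
    refine integrable_cfgProd ((measurable_linkE B).mul (hb2m.comp measurable_snd))
      (C := Real.exp (2 * B) ^ Fintype.card (Edge 3 1) * C' ^ 2) fun p => ?_
    rw [abs_mul]; exact mul_le_mul (abs_linkE_le hB _ _) (hb2b _) (abs_nonneg _) (by positivity)
  have hG : Integrable (fun p : Cfg × Cfg => (1 / 2 : ℝ) * (linkE B p.1 p.2 * a p.1 ^ 2) +
      (1 / 2 : ℝ) * (linkE B p.1 p.2 * b p.2 ^ 2)) ((configMeasure SU2 1).prod (configMeasure SU2 1)) :=
    (hG1.const_mul _).add (hG2.const_mul _)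
  have hpt : ∀ p : Cfg × Cfg, a p.1 * transferKernel su2Rep B p.1 p.2 * b p.2 ≤
      (1 / 2 : ℝ) * (linkE B p.1 p.2 * a p.1 ^ 2) + (1 / 2 : ℝ) * (linkE B p.1 p.2 * b p.2 ^ 2) := by
    intro p
    have hK := transferKernel_pos su2Rep B p.1 p.2
    have hKE := transferKernel_le_linkE hB p.1 p.2
    have a1 : a p.1 * b p.2 * transferKernel su2Rep B p.1 p.2 ≤
        (1 / 2 : ℝ) * (a p.1 ^ 2 + b p.2 ^ 2) * transferKernel su2Rep B p.1 p.2 :=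
      mul_le_mul_of_nonneg_right (by nlinarith [sq_nonneg (a p.1 - b p.2)]) hK.le
    have a2 : (1 / 2 : ℝ) * (a p.1 ^ 2 + b p.2 ^ 2) * transferKernel su2Rep B p.1 p.2 ≤
        (1 / 2 : ℝ) * (a p.1 ^ 2 + b p.2 ^ 2) * linkE B p.1 p.2 :=
      mul_le_mul_of_nonneg_left hKE (by positivity)
    have e : a p.1 * transferKernel su2Rep B p.1 p.2 * b p.2 = a p.1 * b p.2 * transferKernel su2Rep B p.1 p.2 := by ring
    rw [e]; linarith
  calc ∫ p, a p.1 * transferKernel su2Rep B p.1 p.2 * b p.2 ∂(configMeasure SU2 1).prod (configMeasure SU2 1)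
      ≤ ∫ p, (1 / 2 : ℝ) * (linkE B p.1 p.2 * a p.1 ^ 2) + (1 / 2 : ℝ) * (linkE B p.1 p.2 * b p.2 ^ 2)
          ∂(configMeasure SU2 1).prod (configMeasure SU2 1) := integral_mono hI hG hpt
    _ = (1 / 2 : ℝ) * (linkCE B * ∫ U, a U ^ 2 ∂configMeasure SU2 1) +
          (1 / 2 : ℝ) * (linkCE B * ∫ U, b U ^ 2 ∂configMeasure SU2 1) := by
        rw [integral_add (hG1.const_mul _) (hG2.const_mul _), integral_const_mul, integral_const_mul, e1, e2]
    _ = linkCE B / 2 * ((∫ U, a U ^ 2 ∂configMeasure SU2 1) + ∫ U, b U ^ 2 ∂configMeasure SU2 1) := by ring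

/-- `⟨f, K_B f⟩` as a product-measure integral for bounded measurable `f`. [folklore] -/
theorem qform_eq_prodIntegral (hB : 0 ≤ B) {f : Cfg → ℝ} (hfm : Measurable f) (hfb : ∃ C : ℝ, ∀ U, |f U| ≤ C) :
    qform su2Rep B f f = ∫ p, f p.1 * transferKernel su2Rep B p.1 p.2 * f p.2 ∂((configMeasure SU2 1).prod (configMeasure SU2 1)) :=
  (integral_prod _ (integrable_bilin hB hfm hfm hfb hfb)).symm

end Bilinear

end Summit.QuantumFields.YangMills.Theorems.FemtoTransferGap

end
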